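import Literature.NumberTheory.EllipticCurves.TunnellWaldspurgerShapeProofs
import Literature.NumberTheory.EllipticCurves.TunnellFormsCuspidalProofs
import Literature.NumberTheory.EllipticCurves.CongruentNumberCurveLValueTen
import Literature.NumberTheory.EllipticCurves.BSDAnalyticRankTunnellWaldspurgerLValuesProofs
import Mathlib.Tactic.TFAE
import HarnessLib

/-!
# The named leaves of the Tunnell cluster are two single statements:
# `Tunnell1983_waldspurger_chi2 ↔ Tunnell1983_L_one_even` and
# `Tunnell1983_waldspurger_triv ↔ Tunnell1983_L_one_odd`, unconditionally

Bookkeeping file of the Tunnell cluster (`Literature/NumberTheory/EllipticCurves`), for the named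
fact `Literature.NumberTheory.EllipticCurves.Tunnell1983.Tunnell1983_waldspurger_chi2`
(`TunnellHalfIntegralForms`: Waldspurger's theorem [Waldspurger 1981, Thm 1] for Tunnell's forms of
weight `3/2`, level `128`, character `χ₂`, AS APPLIED on p. 329 of Tunnell 1983) and its
trivial-character twin. `TunnellWaldspurgerShapeProofs` proved the equivalences
`Tunnell1983_waldspurger_chi2 ↔ Tunnell1983_L_one_even` (Theorem 3, even twists:
`L(E^{2d}, 1) = b(d)² β/(2√(2d))`) and `Tunnell1983_waldspurger_triv ↔ Tunnell1983_L_one_odd`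
CONDITIONALLY on (M) the membership `g θ₄, g θ₁₆ ∈ S_{3/2}(128, χ₂)` (resp. `g θ₂, g θ₈ ∈
S_{3/2}(128, 1)`) and on the Birch–Swinnerton-Dyer (1965) values `L(E², 1)`, `L(E¹⁰, 1)` (resp.
`L(E, 1)`, `L(E³, 1)`). Both inputs have since been PROVED in the tree:
* (M): `tunnellForm_four/sixteen_mem_halfIntCuspForms`, `tunnellForm_two/eight_mem_halfIntCuspForms`
  (`TunnellFormsCuspidalProofs`, the theta-multiplier chain: Tunnell p. 327, "`{g θ₁, g θ₄, g θ₁₆}`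
  is a basis for the weight `3/2` cusp forms of level `128` and character `χ₈`" — membership half);
* the `L`-values: `BirchSwinnertonDyer1965_L_one_two_ten_holds` (`CongruentNumberCurveLValueTen`),
  `BirchSwinnertonDyer1965_L_one_one_three_holds` (`BSDAnalyticRankTunnellWaldspurgerLValuesProofs`).
Here the hypotheses are discharged (`Tunnell1983_waldspurger_chi2_iff_thm3_even`,
`Tunnell1983_waldspurger_triv_iff_thm3_odd`) and the resulting picture is recorded as two `TFAE`
statements (`Tunnell1983_leaves_even_tfae`, `Tunnell1983_leaves_odd_tfae`): the four named facts
  `Tunnell1983_waldspurger_chi2` (Theorem (Waldspurger) as applied, p. 329, ll. 22–27),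
  `Tunnell1983_b_sq_propto_L_one`, `Tunnell1983_b_sq_eq_const_mul_L_one` (the displays of p. 329),
  `Tunnell1983_L_one_even` (Theorem 3, even twists)
are pairwise equivalent outright, and likewise
  `Tunnell1983_waldspurger_triv`, `Tunnell1983_a_sq_propto_L_one`,
  `Tunnell1983_a_sq_eq_const_mul_L_one`, `Tunnell1983_L_one_odd`.
So each quadruple is ONE open statement — in substance Waldspurger's theorem
`A(t)² ∝ L(φ ⊗ χ₂χ_t, 1)` for the newform `φ` of level `32` together with the Shimura–Niwa
correspondence identifying `S_{3/2}(128, χ, φ)` (Tunnell, Thm 2) — and a proof of any one member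
discharges its class through the equivalences below. Everything here is proved; there are no
definitions and no named facts.

## References

* J. B. Tunnell, *A classical Diophantine problem and modular forms of weight 3/2*, Invent. Math.
  72 (1983) 323–334: Thm 2 (p. 327), Theorem (Waldspurger) (p. 328), Thm 3 and its proof
  (pp. 328–329). [Tunnell1983Congruent]
* J.-L. Waldspurger, *Sur les coefficients de Fourier des formes modulaires de poids demi-entier*,
  J. Math. Pures Appl. 60 (1981) 375–484, Thm 1 and §VIII.4. [Waldspurger1981Fourier]
* B. J. Birch, H. P. F. Swinnerton-Dyer, *Notes on elliptic curves. II*, J. reine angew. Math. 218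
  (1965) 79–108, Table 1. [BirchSwinnertonDyer1965]
-/

namespace Literature.NumberTheory.EllipticCurves.Tunnell1983

/-- **Waldspurger's theorem as applied on p. 329 (character `χ₂`) is equivalent to Theorem 3, even
twists**, unconditionally: `Tunnell1983_waldspurger_chi2_iff_L_one_even` with its membership
hypotheses discharged by `tunnellForm_four/sixteen_mem_halfIntCuspForms` and its `L`-value
hypothesis by `BirchSwinnertonDyer1965_L_one_two_ten_holds`.
[cite: Tunnell1983Congruent, Theorem (Waldspurger) p. 328; Thm 3 and its proof, pp. 328–329] -/
theorem Tunnell1983_waldspurger_chi2_iff_thm3_even :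
    Tunnell1983_waldspurger_chi2 ↔ Tunnell1983_L_one_even :=
  Tunnell1983_waldspurger_chi2_iff_L_one_even tunnellForm_four_mem_halfIntCuspForms
    tunnellForm_sixteen_mem_halfIntCuspForms BirchSwinnertonDyer1965_L_one_two_ten_holds

/-- **Waldspurger's theorem as applied on p. 329 (trivial character) is equivalent to Theorem 3,
odd twists**, unconditionally (`Tunnell1983_waldspurger_triv_iff_L_one_odd` with
`tunnellForm_two/eight_mem_halfIntCuspForms` and `BirchSwinnertonDyer1965_L_one_one_three_holds`).
[cite: Tunnell1983Congruent, Theorem (Waldspurger) p. 328; Thm 3 and its proof, pp. 328–329] -/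
theorem Tunnell1983_waldspurger_triv_iff_thm3_odd :
    Tunnell1983_waldspurger_triv ↔ Tunnell1983_L_one_odd :=
  Tunnell1983_waldspurger_triv_iff_L_one_odd tunnellForm_two_mem_halfIntCuspForms
    tunnellForm_eight_mem_halfIntCuspForms BirchSwinnertonDyer1965_L_one_one_three_holds

/-- **The four even-case leaves of the Tunnell cluster are pairwise equivalent**: Waldspurger's
theorem as applied on p. 329 for `χ₂` (`Tunnell1983_waldspurger_chi2`), the class-`1, 5`
proportionality `b(n)² = γᵣ² L(E²ⁿ, 1) √n` (`Tunnell1983_b_sq_propto_L_one`), the same with the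
vanishing on the classes `3, 7` (`Tunnell1983_b_sq_eq_const_mul_L_one`), and Theorem 3 for even
twists (`Tunnell1983_L_one_even`).
[cite: Tunnell1983Congruent, Theorem (Waldspurger) p. 328; proof of Thm 3, p. 329, ll. 22–27] -/
theorem Tunnell1983_leaves_even_tfae :
    [Tunnell1983_waldspurger_chi2, Tunnell1983_b_sq_propto_L_one,
      Tunnell1983_b_sq_eq_const_mul_L_one, Tunnell1983_L_one_even].TFAE := by
  tfae_have 1 ↔ 2 := Tunnell1983_waldspurger_chi2_iff_propto
  tfae_have 3 ↔ 2 := Tunnell1983_b_sq_eq_const_mul_L_one_iff_propto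
  tfae_have 1 ↔ 4 := Tunnell1983_waldspurger_chi2_iff_thm3_even
  tfae_finish

/-- **The four odd-case leaves of the Tunnell cluster are pairwise equivalent**:
`Tunnell1983_waldspurger_triv`, `Tunnell1983_a_sq_propto_L_one` (classes `1, 3`),
`Tunnell1983_a_sq_eq_const_mul_L_one`, and Theorem 3 for odd twists (`Tunnell1983_L_one_odd`,
`L(E^d, 1) = a(d)² β/(4√d)`).
[cite: Tunnell1983Congruent, Theorem (Waldspurger) p. 328; proof of Thm 3, p. 329, ll. 7–12] -/
theorem Tunnell1983_leaves_odd_tfae :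
    [Tunnell1983_waldspurger_triv, Tunnell1983_a_sq_propto_L_one,
      Tunnell1983_a_sq_eq_const_mul_L_one, Tunnell1983_L_one_odd].TFAE := by
  tfae_have 1 ↔ 2 := Tunnell1983_waldspurger_triv_iff_propto
  tfae_have 3 ↔ 2 := Tunnell1983_a_sq_eq_const_mul_L_one_iff_propto
  tfae_have 1 ↔ 4 := Tunnell1983_waldspurger_triv_iff_thm3_odd
  tfae_finish

/-- In particular a proof of Theorem 3 (even twists) would discharge
`Tunnell1983_waldspurger_chi2`, and conversely; likewise a proof of the class-`1, 5`
proportionality of p. 329 discharges it via `Tunnell1983_waldspurger_chi2_iff_propto.mpr`.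
[folklore] -/
theorem Tunnell1983_waldspurger_chi2_of_thm3_even (hT : Tunnell1983_L_one_even) :
    Tunnell1983_waldspurger_chi2 :=
  Tunnell1983_waldspurger_chi2_iff_thm3_even.mpr hT

end Literature.NumberTheory.EllipticCurves.Tunnell1983
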